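import Mathlib
import HarnessLib
import Summits.HubbardSuperconductivity.HubbardSuperconductivity.Theorems.KLProgrammeKLRegimeVolumeLimitHartreeLimit
import Summits.HubbardSuperconductivity.HubbardSuperconductivity.Theorems.KLProgrammeKLRegimeVolumeLimitAlgebra

/-!
# Child 5 `KLRegimeVolumeLimitV7` (stmt-HubbardSuperconductivity-19665) — the FIRST-ORDER TAYLOR TRUNCATION of the volume-limit carrier satisfies
# the VL text at every coupling (seat hubbard-kl-k3c5-p2)

The two landed rungs — `finalTwoLegVolLimit_zero_coupling` (U⁰: `Σ̂^K(U=0)` grid-exact) and `firstOrder_volLimit` (U¹: `d/dU|₀ Σ̂^K`, the frame-dressed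
Hartree tadpole) — combined by the model-free algebra of VL clauses (`…VolumeLimitAlgebra`: scalar dressing `U ·`, then sum): for every `U`, `β > 0`, `μ`,
frame `K` and thresholds `Mstar`, the degree-one Taylor polynomial in the coupling of the carrier,

  `T₁(L,M;k,σ;U) := klSelfEnergy L M β 0 μ K klE0 (nScales β+1) k σ + U · d/dU|₀ klSelfEnergy L M β · μ K klE0 (nScales β+1) k σ`,

satisfies the three clauses of `FinalTwoLegVolLimit` verbatim (`firstOrderTaylor_volLimit`).  This is the order-`≤ 1` witness of child 5 as ONE citable
statement; the order-`U²` term is k3c5-p3's.  Pure assembly; no definition.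
-/

noncomputable section

namespace Summit.HubbardSuperconductivity.HubbardSuperconductivity.Theorems.TwoPointAssembly

set_option linter.dupNamespace false -- summit = problem name (single-conjunct summit), D-0017

open Finset Filter Topology Literature.MathematicalPhysics.QuantumLattice Literature.Probability.LatticeModels GrassmannAlgebra
open Summit.HubbardSuperconductivity.HubbardSuperconductivity.Theorems.KLRegimeSplit
open Summit.HubbardSuperconductivity.HubbardSuperconductivity.Theorems.KLProgrammeLegKernels

/-- **The first-order Taylor truncation of the VL carrier satisfies the VL clauses at every `U`.** -/
theorem firstOrderTaylor_volLimit {β : ℝ} (hβ : 0 < β) (U μ : ℝ) (K : TrigPolyC4v) (Mstar : ℕ → ℕ) :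
    ∃ sigmaInf : ℤ → (Fin 2 → ℝ) → Fin 2 → ℂ, ∃ B : ℝ, ∃ L₀ : ℕ,
      (∀ (n : ℤ) (σ : Fin 2), Continuous fun p : Fin 2 → ℝ => sigmaInf n p σ) ∧
      (∀ (L : ℕ) [NeZero L], L₀ ≤ L → ∀ (M : ℕ) [NeZero M], Mstar L ≤ M →
        ∀ (k : FreqMomentum L M) (σ : Fin 2),
          ‖klSelfEnergy L M β 0 μ K klE0 (nScales β + 1) k σ +
              (U : ℂ) * deriv (fun U' : ℝ => klSelfEnergy L M β U' μ K klE0 (nScales β + 1) k σ) 0‖ ≤ B) ∧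
      (∀ (n : ℤ) (σ : Fin 2) (ε : ℝ), 0 < ε → ∃ L₁ : ℕ, ∀ (L : ℕ) [NeZero L], L₁ ≤ L →
        ∃ M₁ : ℕ, ∀ (M : ℕ) [NeZero M], M₁ ≤ M → ∀ ω : MatsubaraIdx M, matsubaraInt M ω = n →
          ∀ k : TorusSite 2 L,
            ‖(klSelfEnergy L M β 0 μ K klE0 (nScales β + 1) (ω, k) σ +
                (U : ℂ) * deriv (fun U' : ℝ => klSelfEnergy L M β U' μ K klE0 (nScales β + 1) (ω, k) σ) 0) -
              sigmaInf n (latticeMomentum L k) σ‖ ≤ ε) := by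
  -- the two rungs
  obtain ⟨sig0, B0, L0, hc0, hb0, hl0⟩ := finalTwoLegVolLimit_zero_coupling hβ μ K Mstar
  obtain ⟨sig1, B1, L1, hc1, hb1, hl1⟩ := firstOrder_volLimit hβ μ K Mstar
  -- dress the U¹ rung by the constant `U`
  have hB1 : 0 ≤ B1 := by
    -- the bound is attained by a norm at some volume: take `L = max L1 1`, `M = max (Mstar L) 1`, any label
    set L' : ℕ := max L1 1 with hL'
    haveI : NeZero L' := ⟨by omega⟩
    set M' : ℕ := max (Mstar L') 1 with hM'
    haveI : NeZero M' := ⟨by omega⟩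
    have hM'pos : 0 < 2 * M' := by omega
    have h := hb1 L' (le_max_left _ _) M' (le_max_left _ _) ((⟨0, hM'pos⟩ : MatsubaraIdx M'), fun _ => 0) 0
    exact le_trans (norm_nonneg _) h
  have hd := volLimitShape_dressing_mul (S := fun L M _ _ k σ => deriv (fun U' : ℝ => klSelfEnergy L M β U' μ K klE0 (nScales β + 1) k σ) 0)
    (Mstar := Mstar) (Φ := fun L M _ _ _ => (U : ℂ)) (φ := fun _ _ => (U : ℂ)) (Bφ := ‖(U : ℂ)‖) (norm_nonneg _)
    (fun _ => continuous_const) (fun _ _ => le_rfl) (fun _ _ _ _ _ _ => rfl) hc1 hb1 hl1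
  obtain ⟨hcd, hbd, hld⟩ := hd
  -- add the U⁰ rung
  have hsum := volLimitShape_add (Mstar := Mstar) hc0 hb0 hl0 hcd hbd hld
  obtain ⟨hcs, hbs, hls⟩ := hsum
  exact ⟨fun n p σ => sig0 n p σ + (U : ℂ) * sig1 n p σ, B0 + ‖(U : ℂ)‖ * B1, max L0 L1, hcs, hbs, hls⟩

end Summit.HubbardSuperconductivity.HubbardSuperconductivity.Theorems.TwoPointAssembly

end
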